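import Summits.Schanuel.Schanuel.Theorems.ZilberEacLineCurveComplexDensity
import HarnessLib

/-!
# Product surfaces over graph bases: Mantova–Masser's FREE density question holds for every
# `{x₁ = p(x₀)} × Z(P)` (all `p ∈ ℂ[x]`, all irreducible `P ∈ ℂ[y₀, y₁]`)

HONEST FRAMING.  Cell `pub-schanuel` (Zilber's Exponential-Algebraic Closedness, case ladder;
host summit Schanuel), seat 2, gen 16.  Mantova–Masser (PLMS 129 (2024) = arXiv:2303.05592,
§1 p. 5) ask whether the exponential points of a surface `W ⊆ ℂ² × ℂ²` of their case
(dim-π-S-1-free) are Zariski dense in `W`; in its FREE form (additionally `W ∩ G²` multiplicatively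
free — the repair of `EACDensityOscillatory`, and the form equivalent to the periodic piece
`Fib(3,2)` of the open cell `EC(3,2)`, `ZilberEacDensityConverse`) the question is OPEN in general.
This file DECIDES it, affirmatively, for every product surface whose base is a graph over a
coordinate axis:

* `unprojectedDense_graphCurve_of_mmCase_of_isMulFree`: for EVERY `p ∈ ℂ[x]` and EVERY
  irreducible `P ∈ ℂ[y₀, y₁]`, if `W = {x₁ = p(x₀)} × Z(P)` is in case (dim-π-S-1-free) and
  `W ∩ G²` is multiplicatively free, then `I(W ∩ Γ_exp) = I(W)`.

The proof is an assembly.  Vertical-line fibres `y₀ = r` (the irreducible `P` all of whose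
monomials have the same `y₁`-degree, Part A: `P = (X₀ - r) · unit`) make `W` the constant-fibre
surface `graphPolySurface p (C r)`, which is never free (`y₀ ≡ r`); every other fibre has two
monomials of different `y₁`-degree, and then: `deg p ≥ 2` — `unprojectedDense_graphCurveSurface`
(gen 16, Newton-polygon escape); `deg p ≤ 1`, slope `a = p'`: the case hypothesis forces `a ∉ ℚ`
(`mmCase_graphPolySurface_line_iff`, seat 1), and `Im a ≠ 0` is
`unprojectedDense_lineCurveSurface_of_im_ne_zero` (gen 16, degree-one escape) while a real
irrational `a` is seat 1's `unprojectedDense_lineCurveSurface` (Kronecker + minimum modulus).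
By-products: over a non-real line EVERY irreducible fibre is dense
(`unprojectedDense_lineCurveSurfaceC_of_mmCase`, the vertical lines by
`unprojectedDense_line_const_iff`), and over a graph of degree `≥ 2` the non-free fibres are decided
by the phase criterion of `EACDensityPhases` (`unprojectedDense_graphCurveSurface_vertical_iff`).

What stays OPEN (precisely): base curves that are not graphs over a coordinate axis
(`{x₀² = x₁³}`, …), non-split surfaces (fibre depending on the base point), and of course
`EC(3,2)` and the free question for all surfaces.  NOT Schanuel's conjecture (neither used nor
implied; EAC ⇏ SC).
-/

noncomputable section

open Filter Topology Set Complex MvPolynomial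
open Literature.NumberTheory.Transcendental Literature.ModelTheory.Zilber
open Literature.ModelTheory.ExponentialFields

set_option linter.dupNamespace false

namespace Summit.Schanuel.Schanuel.Theorems

/-! ## Part A. Irreducible fibre polynomials with all monomials of one `y₁`-degree are vertical
lines -/

section Vertical

variable {P : MvPolynomial (Fin 2) ℂ}

/-- If every monomial of `P` has `y₁`-degree `j₀`, then `P = X₁^{j₀} · p₀(X₀)` with
`p₀ = Σ_v c_v X^{v₀}`. -/
theorem eq_X_pow_mul_aeval_of_sameDegree {j₀ : ℕ} (h : ∀ v ∈ P.support, v 1 = j₀) :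
    P = MvPolynomial.X 1 ^ j₀ * Polynomial.aeval (MvPolynomial.X 0 : MvPolynomial (Fin 2) ℂ)
      (∑ v ∈ P.support, Polynomial.C (P.coeff v) * Polynomial.X ^ (v 0)) := by
  classical
  rw [map_sum, Finset.mul_sum]
  conv_lhs => rw [P.as_sum]
  refine Finset.sum_congr rfl fun v hv => ?_
  have hv' : v = Finsupp.single 0 (v 0) + Finsupp.single 1 j₀ := by
    ext i
    fin_cases i
    · simp
    · simp [h v hv]
  have hm : MvPolynomial.monomial v (P.coeff v) =
      MvPolynomial.X 0 ^ (v 0) * (MvPolynomial.C (P.coeff v) * MvPolynomial.X 1 ^ j₀) := by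
    rw [MvPolynomial.C_mul_X_pow_eq_monomial, ← MvPolynomial.monomial_single_add, ← hv']
  rw [hm, map_mul, Polynomial.aeval_C, map_pow, Polynomial.aeval_X, MvPolynomial.algebraMap_eq]
  ring

/-- Evaluation of such a `P`: `P(y) = y₁^{j₀} p₀(y₀)`. -/
theorem eval_eq_of_sameDegree {j₀ : ℕ} (h : ∀ v ∈ P.support, v 1 = j₀) (y : Fin 2 → ℂ) :
    MvPolynomial.eval y P = y 1 ^ j₀ *
      (∑ v ∈ P.support, Polynomial.C (P.coeff v) * Polynomial.X ^ (v 0)).eval (y 0) := by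
  conv_lhs => rw [eq_X_pow_mul_aeval_of_sameDegree h]
  rw [map_mul, map_pow, MvPolynomial.eval_X, eval_polynomial_aeval_X]

/-- Units of `ℂ[y₀, y₁]` have no zeros. -/
theorem eval_ne_zero_of_isUnit {U : MvPolynomial (Fin 2) ℂ} (hU : IsUnit U) (y : Fin 2 → ℂ) :
    MvPolynomial.eval y U ≠ 0 :=
  (hU.map (MvPolynomial.eval y)).ne_zero

/-- **Vertical lines.**  Let `P` be irreducible, with NO two monomials of different `y₁`-degree,
and with a zero `c`, `c₁ ≠ 0`.  Then `Z(P) = {y₀ = c₀}`: `P` vanishes at `y` iff `y₀ = c₀`.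
(Factor `p₀ = (X - c₀) q₀`; then `P = (X₀ - c₀) · (X₁^{j₀} q₀(X₀))` and irreducibility makes the
second factor a unit, since `X₀ - c₀` is not.) (new) -/
theorem eval_eq_zero_iff_of_sameDegree (hirr : Irreducible P)
    (h : ¬ ∃ v ∈ P.support, ∃ v' ∈ P.support, v 1 ≠ v' 1) {c : Fin 2 → ℂ} (h1 : c 1 ≠ 0)
    (hc : MvPolynomial.eval c P = 0) (y : Fin 2 → ℂ) :
    MvPolynomial.eval y P = 0 ↔ y 0 = c 0 := by
  classical
  push Not at h
  have hP0 : P ≠ 0 := hirr.ne_zero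
  obtain ⟨v₀, hv₀⟩ := MvPolynomial.support_nonempty.2 hP0
  set j₀ := v₀ 1 with hj₀
  have hall : ∀ v ∈ P.support, v 1 = j₀ := fun v hv => h v hv v₀ hv₀
  set p₀ : Polynomial ℂ := ∑ v ∈ P.support, Polynomial.C (P.coeff v) * Polynomial.X ^ (v 0)
    with hp₀
  -- `c₀` is a root of `p₀`
  have hroot : p₀.IsRoot (c 0) := by
    have e := eval_eq_of_sameDegree hall c
    rw [hc] at e
    have := (mul_eq_zero.1 e.symm).resolve_left (pow_ne_zero _ h1)
    exact this
  -- factor and read the factorisation in `ℂ[y₀, y₁]`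
  have hfac0 := Polynomial.mul_divByMonic_eq_iff_isRoot.2 hroot
  set q₀ : Polynomial ℂ := p₀ /ₘ (Polynomial.X - Polynomial.C (c 0)) with hq₀
  have hfac : P = (MvPolynomial.X 0 - MvPolynomial.C (c 0)) *
      (MvPolynomial.X 1 ^ j₀ * Polynomial.aeval (MvPolynomial.X 0 : MvPolynomial (Fin 2) ℂ) q₀) := by
    conv_lhs => rw [eq_X_pow_mul_aeval_of_sameDegree hall, ← hp₀, ← hfac0]
    rw [map_mul, map_sub, Polynomial.aeval_X, Polynomial.aeval_C, MvPolynomial.algebraMap_eq]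
    ring
  have hnotunit : ¬ IsUnit (MvPolynomial.X 0 - MvPolynomial.C (c 0) : MvPolynomial (Fin 2) ℂ) := by
    intro hu
    have := eval_ne_zero_of_isUnit hu ![c 0, 0]
    simp at this
  have hU : IsUnit (MvPolynomial.X 1 ^ j₀ *
      Polynomial.aeval (MvPolynomial.X 0 : MvPolynomial (Fin 2) ℂ) q₀) :=
    (hirr.isUnit_or_isUnit hfac).resolve_left hnotunit
  rw [hfac, map_mul, mul_eq_zero, map_sub, MvPolynomial.eval_X, MvPolynomial.eval_C, sub_eq_zero]
  constructor
  · rintro (h0 | h0)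
    · exact h0
    · exact absurd h0 (eval_ne_zero_of_isUnit hU y)
  · exact fun h0 => Or.inl h0

/-- Consequently such a `W = {x₁ = p(x₀)} × Z(P)` IS the constant-fibre surface
`graphPolySurface p (C c₀) = {x₁ = p(x₀), y₀ = c₀}`. (new) -/
theorem setOf_eq_graphPolySurface_C_of_sameDegree (p : Polynomial ℂ) (hirr : Irreducible P)
    (h : ¬ ∃ v ∈ P.support, ∃ v' ∈ P.support, v 1 ≠ v' 1) {c : Fin 2 → ℂ} (h1 : c 1 ≠ 0)
    (hc : MvPolynomial.eval c P = 0) :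
    {w : Fin 2 ⊕ Fin 2 → ℂ | w (Sum.inl 1) = p.eval (w (Sum.inl 0)) ∧
      MvPolynomial.eval (fun i => w (Sum.inr i)) P = 0} = graphPolySurface p (Polynomial.C (c 0)) := by
  ext w
  rw [mem_graphPolySurface_iff, Set.mem_setOf_eq, eval_eq_zero_iff_of_sameDegree hirr h h1 hc,
    Polynomial.eval_C]

/-- … and then `y₀ ≡ c₀` on `W ∩ G²`, so `W ∩ G²` is NOT multiplicatively free. (new) -/
theorem not_isMulFree_of_sameDegree (p : Polynomial ℂ) (hirr : Irreducible P)
    (h : ¬ ∃ v ∈ P.support, ∃ v' ∈ P.support, v 1 ≠ v' 1) {c : Fin 2 → ℂ} (h1 : c 1 ≠ 0)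
    (hc : MvPolynomial.eval c P = 0) :
    ¬ IsMulFree ℂ 2 ({w : Fin 2 ⊕ Fin 2 → ℂ | w (Sum.inl 1) = p.eval (w (Sum.inl 0)) ∧
      MvPolynomial.eval (fun i => w (Sum.inr i)) P = 0} ∩ torusLocus ℂ 2) := by
  intro hfree
  refine hfree (Pi.single 0 1) ?_ ⟨c 0, fun z hz => ?_⟩
  · intro h0
    have := congrFun h0 0
    simp at this
  · have hz0 : z (Sum.inr 0) = c 0 :=
      (eval_eq_zero_iff_of_sameDegree hirr h h1 hc (fun i => z (Sum.inr i))).1 hz.1.2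
    rw [Fin.prod_univ_two, Pi.single_eq_same, Pi.single_eq_of_ne (by decide : (1 : Fin 2) ≠ 0),
      zpow_one, zpow_zero, mul_one, hz0]

end Vertical

/-! ## Part B. Graph bases of degree `≥ 2`: free ⟹ dense; the non-free fibres by phases -/

section Graph

variable (p : Polynomial ℂ) {P : MvPolynomial (Fin 2) ℂ}

/-- **Free ⟹ dense over graph bases.**  `deg p ≥ 2`, `P` irreducible, `W = {x₁ = p(x₀)} × Z(P)`
with a torus point and `W ∩ G²` multiplicatively free: the exponential points of `W` are Zariski
dense.  (Freeness excludes exactly the vertical-line fibres.)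
[cite: MantovaMasser2023, §1 Further remarks, p. 5 (the question, open in general)] (new) -/
theorem unprojectedDense_graphCurveSurface_of_isMulFree (hd : 2 ≤ p.natDegree)
    (hirr : Irreducible P)
    (hW : ({w : Fin 2 ⊕ Fin 2 → ℂ | w (Sum.inl 1) = p.eval (w (Sum.inl 0)) ∧
        MvPolynomial.eval (fun i => w (Sum.inr i)) P = 0} ∩ torusLocus ℂ 2).Nonempty)
    (hfree : IsMulFree ℂ 2 ({w : Fin 2 ⊕ Fin 2 → ℂ | w (Sum.inl 1) = p.eval (w (Sum.inl 0)) ∧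
        MvPolynomial.eval (fun i => w (Sum.inr i)) P = 0} ∩ torusLocus ℂ 2)) :
    UnprojectedDense {w : Fin 2 ⊕ Fin 2 → ℂ | w (Sum.inl 1) = p.eval (w (Sum.inl 0)) ∧
      MvPolynomial.eval (fun i => w (Sum.inr i)) P = 0} := by
  by_cases h2 : ∃ v ∈ P.support, ∃ v' ∈ P.support, v 1 ≠ v' 1
  · exact unprojectedDense_graphCurveSurface p hd hirr h2
  · exfalso
    obtain ⟨c, -, h1, hc⟩ := (graphCurveSurface_inter_torusLocus_nonempty_iff p P).1 hW
    exact not_isMulFree_of_sameDegree p hirr h2 h1 hc hfree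

/-- **The non-free fibres over a graph base are decided by phases.**  If `P` is irreducible with no
two monomials of different `y₁`-degree and a torus zero `c` (so `Z(P)` is the vertical line
`y₀ = c₀`), then `W = {x₁ = p(x₀), y₀ = c₀}` and its exponential points are dense iff some
positive-degree coefficient of the phase polynomial `p(log c₀ + 2πi t)` is not in `ℚ · 2πi`
(`EACDensityPhases.unprojectedDense_const_iff`). (new) -/
theorem unprojectedDense_graphCurveSurface_vertical_iff (hirr : Irreducible P)
    (h : ¬ ∃ v ∈ P.support, ∃ v' ∈ P.support, v 1 ≠ v' 1) {c : Fin 2 → ℂ} (h0 : c 0 ≠ 0)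
    (h1 : c 1 ≠ 0) (hc : MvPolynomial.eval c P = 0) :
    UnprojectedDense {w : Fin 2 ⊕ Fin 2 → ℂ | w (Sum.inl 1) = p.eval (w (Sum.inl 0)) ∧
        MvPolynomial.eval (fun i => w (Sum.inr i)) P = 0} ↔
      ¬ ∀ j, 0 < j → ∃ r : ℚ, (phasePoly p (Complex.log (c 0))).coeff j = (r : ℂ) * (2 * Real.pi * I) := by
  rw [setOf_eq_graphPolySurface_C_of_sameDegree p hirr h h1 hc]
  exact unprojectedDense_const_iff (Complex.exp_log h0)

end Graph

/-! ## Part C. Lines of non-real slope: every irreducible fibre -/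

section LineAll

variable (a b : ℂ) {P : MvPolynomial (Fin 2) ℂ}

/-- **Over a line of non-real slope EVERY irreducible fibre curve is dense**: `Im a ≠ 0`, `P`
irreducible with a zero in `(ℂˣ)²` ⟹ the exponential points of `{x₁ = a x₀ + b} × Z(P)` are
Zariski dense (vertical-line fibres are the constant-fibre surfaces over a line of slope `∉ ℚ`,
`unprojectedDense_line_const_iff`; all others by `unprojectedDense_lineCurveSurface_of_im_ne_zero`).
(new) -/
theorem unprojectedDense_lineCurveSurfaceC_all (ha : a.im ≠ 0) (hirr : Irreducible P)
    (hW : ({w : Fin 2 ⊕ Fin 2 → ℂ | w (Sum.inl 1) = (linePoly a b).eval (w (Sum.inl 0)) ∧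
        MvPolynomial.eval (fun i => w (Sum.inr i)) P = 0} ∩ torusLocus ℂ 2).Nonempty) :
    UnprojectedDense {w : Fin 2 ⊕ Fin 2 → ℂ | w (Sum.inl 1) = (linePoly a b).eval (w (Sum.inl 0)) ∧
      MvPolynomial.eval (fun i => w (Sum.inr i)) P = 0} := by
  by_cases h2 : ∃ v ∈ P.support, ∃ v' ∈ P.support, v 1 ≠ v' 1
  · exact unprojectedDense_lineCurveSurface_of_im_ne_zero a b ha hirr h2
  · obtain ⟨c, h0, h1, hc⟩ := (graphCurveSurface_inter_torusLocus_nonempty_iff (linePoly a b) P).1 hW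
    rw [setOf_eq_graphPolySurface_C_of_sameDegree (linePoly a b) hirr h2 h1 hc]
    refine (unprojectedDense_line_const_iff (Complex.exp_log h0)).2 fun r hr => ha ?_
    rw [hr]; simp

/-- … in Mantova–Masser's form: case (dim-π-S-1-free) ⟹ dense, for every irreducible `P` over a
line of non-real slope. [cite: MantovaMasser2023, §1 Further remarks, p. 5] (new) -/
theorem unprojectedDense_lineCurveSurfaceC_of_mmCase (ha : a.im ≠ 0) (hirr : Irreducible P)
    (hmm : MMCaseDimPiOneFree {w : Fin 2 ⊕ Fin 2 → ℂ |
        w (Sum.inl 1) = (linePoly a b).eval (w (Sum.inl 0)) ∧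
        MvPolynomial.eval (fun i => w (Sum.inr i)) P = 0}) :
    UnprojectedDense {w : Fin 2 ⊕ Fin 2 → ℂ | w (Sum.inl 1) = (linePoly a b).eval (w (Sum.inl 0)) ∧
      MvPolynomial.eval (fun i => w (Sum.inr i)) P = 0} :=
  unprojectedDense_lineCurveSurfaceC_all a b ha hirr hmm.2.1

end LineAll

/-! ## Part D. The assembly: every `p`, every irreducible `P` -/

/-- The slope of a base of degree `≤ 1` in the case is not rational (transfer of seat 1's
`mmCase_graphPolySurface_line_iff` through the common base). -/
theorem forall_rat_ne_of_mmCase_line (a b : ℂ) {P : MvPolynomial (Fin 2) ℂ}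
    (hmm : MMCaseDimPiOneFree {w : Fin 2 ⊕ Fin 2 → ℂ |
        w (Sum.inl 1) = (linePoly a b).eval (w (Sum.inl 0)) ∧
        MvPolynomial.eval (fun i => w (Sum.inr i)) P = 0}) :
    ∀ r : ℚ, a ≠ (r : ℂ) := by
  have hW := hmm.2.1
  have hnl := hmm.2.2.2.2
  rw [projAdd_image_graphCurveSurface_inter_torusLocus (linePoly a b) hW] at hnl
  have hmm' : MMCaseDimPiOneFree (graphPolySurface (linePoly a b) Polynomial.X) :=
    ⟨isIrreducibleClosed_graphPolySurface _ _,
      graphPolySurface_inter_torusLocus_nonempty _ Polynomial.X_ne_zero,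
      zariskiDim_graphPolySurface _ _, addProjDim_graphPolySurface _ Polynomial.X_ne_zero, hnl⟩
  exact (mmCase_graphPolySurface_line_iff a b Polynomial.X_ne_zero).1 hmm'

/-- **MAIN THEOREM OF THE ASSEMBLY.  Mantova–Masser's FREE density question holds for every product
surface over a graph base.**  For EVERY `p ∈ ℂ[x]` and EVERY irreducible `P ∈ ℂ[y₀, y₁]`: if
`W = {x₁ = p(x₀)} × Z(P)` satisfies the hypotheses of case (dim-π-S-1-free) and `W ∩ G²` is
multiplicatively free, then the exponential points of `W` are Zariski dense, `I(W ∩ Γ_exp) = I(W)`.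
[cite: MantovaMasser2023, §1 Further remarks, p. 5 (the question; OPEN for general surfaces)]
(new) -/
theorem unprojectedDense_graphCurve_of_mmCase_of_isMulFree (p : Polynomial ℂ)
    {P : MvPolynomial (Fin 2) ℂ} (hirr : Irreducible P)
    (hmm : MMCaseDimPiOneFree {w : Fin 2 ⊕ Fin 2 → ℂ | w (Sum.inl 1) = p.eval (w (Sum.inl 0)) ∧
        MvPolynomial.eval (fun i => w (Sum.inr i)) P = 0})
    (hfree : IsMulFree ℂ 2 ({w : Fin 2 ⊕ Fin 2 → ℂ | w (Sum.inl 1) = p.eval (w (Sum.inl 0)) ∧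
        MvPolynomial.eval (fun i => w (Sum.inr i)) P = 0} ∩ torusLocus ℂ 2)) :
    UnprojectedDense {w : Fin 2 ⊕ Fin 2 → ℂ | w (Sum.inl 1) = p.eval (w (Sum.inl 0)) ∧
      MvPolynomial.eval (fun i => w (Sum.inr i)) P = 0} := by
  by_cases hd : 2 ≤ p.natDegree
  · exact unprojectedDense_graphCurveSurface_of_isMulFree p hd hirr hmm.2.1 hfree
  · -- `deg p ≤ 1`: the base is the line `x₁ = a x₀ + b`
    have hp : p = linePoly (p.coeff 1) (p.coeff 0) :=
      Polynomial.eq_X_add_C_of_natDegree_le_one (by omega)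
    set a := p.coeff 1 with ha_def
    set b := p.coeff 0 with hb_def
    rw [hp] at hmm hfree ⊢
    have hrat := forall_rat_ne_of_mmCase_line a b hmm
    by_cases him : a.im ≠ 0
    · exact unprojectedDense_lineCurveSurfaceC_all a b him hirr hmm.2.1
    · rw [not_not] at him
      have hare : ((a.re : ℝ) : ℂ) = a := by
        apply Complex.ext <;> simp [him]
      have hirr' : Irrational a.re := by
        rintro ⟨r, hr⟩
        apply hrat r
        rw [← hare, ← hr]
        norm_cast
      have hW' : (lineCurveSurface a.re b P ∩ torusLocus ℂ 2).Nonempty := by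
        rw [lineCurveSurface_eq_setOf, hare]; exact hmm.2.1
      have h := unprojectedDense_lineCurveSurface hirr' b hirr hW'
      rwa [lineCurveSurface_eq_setOf, hare] at h

/-- The same over graphs `x₀ = p(x₁)` of the other coordinate (index swap of
`EACDensityTransport`; the case and freeness are swap-invariant). (new) -/
theorem unprojectedDense_graphCurve_swap_of_mmCase_of_isMulFree (p : Polynomial ℂ)
    {P : MvPolynomial (Fin 2) ℂ} (hirr : Irreducible P)
    (hmm : MMCaseDimPiOneFree {w : Fin 2 ⊕ Fin 2 → ℂ | w (Sum.inl 0) = p.eval (w (Sum.inl 1)) ∧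
        MvPolynomial.eval (fun i => w (Sum.inr i)) P = 0})
    (hfree : IsMulFree ℂ 2 ({w : Fin 2 ⊕ Fin 2 → ℂ | w (Sum.inl 0) = p.eval (w (Sum.inl 1)) ∧
        MvPolynomial.eval (fun i => w (Sum.inr i)) P = 0} ∩ torusLocus ℂ 2)) :
    UnprojectedDense {w : Fin 2 ⊕ Fin 2 → ℂ | w (Sum.inl 0) = p.eval (w (Sum.inl 1)) ∧
      MvPolynomial.eval (fun i => w (Sum.inr i)) P = 0} := by
  classical
  set σ : Fin 2 ≃ Fin 2 := Equiv.swap 0 1 with hσ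
  set P' : MvPolynomial (Fin 2) ℂ := rename σ P with hP'
  have hirr' : Irreducible P' := (MulEquiv.irreducible_iff (renameEquiv ℂ σ)).2 hirr
  have hset : indexSwapped {w : Fin 2 ⊕ Fin 2 → ℂ | w (Sum.inl 1) = p.eval (w (Sum.inl 0)) ∧
      MvPolynomial.eval (fun i => w (Sum.inr i)) P' = 0} =
      {w : Fin 2 ⊕ Fin 2 → ℂ | w (Sum.inl 0) = p.eval (w (Sum.inl 1)) ∧
        MvPolynomial.eval (fun i => w (Sum.inr i)) P = 0} := by
    ext w
    have e : MvPolynomial.eval (fun i => (w ∘ idxSwap) (Sum.inr i)) P' =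
        MvPolynomial.eval (fun i => w (Sum.inr i)) P := by
      rw [hP', eval_rename]
      have hfun : ((fun i => (w ∘ idxSwap) (Sum.inr i)) ∘ ⇑σ) = fun i => w (Sum.inr i) := by
        funext i
        fin_cases i <;> simp [hσ, idxSwap_inr]
      rw [hfun]
    simp only [mem_indexSwapped_iff, Set.mem_setOf_eq, e]
    simp
  have hset' : indexSwapped {w : Fin 2 ⊕ Fin 2 → ℂ | w (Sum.inl 0) = p.eval (w (Sum.inl 1)) ∧
        MvPolynomial.eval (fun i => w (Sum.inr i)) P = 0} =
      {w : Fin 2 ⊕ Fin 2 → ℂ | w (Sum.inl 1) = p.eval (w (Sum.inl 0)) ∧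
        MvPolynomial.eval (fun i => w (Sum.inr i)) P' = 0} := by
    rw [← hset, indexSwapped_indexSwapped]
  have hmm' := mmCaseDimPiOneFree_indexSwapped hmm
  have hfree' := isMulFree_indexSwapped_inter hfree
  rw [hset'] at hmm' hfree'
  rw [← hset]
  exact unprojectedDense_indexSwapped
    (unprojectedDense_graphCurve_of_mmCase_of_isMulFree p hirr' hmm' hfree')

end Summit.Schanuel.Schanuel.Theorems
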